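import Summits.HodgeConjecture.HodgeConjecture.Theorems.R90S6HeckeCoeffIndepOfIso
import Summits.HodgeConjecture.HodgeConjecture.Theorems.R90S6IndexSeparatesU2

/-!
# R90 · S6 (Rogawski Ch. 14.1–5, stable trace formula) — W9-A.4: «eG-independence» at `N = 2` — the Hecke functions `g ↦ (T [K₀])((e g) K₀)` on a
# group `Gv` transported onto `U(σ, antidiag(1,1))(K)` do not depend on the transport `e` (`Theorems/R90S6HeckeCoeffIndepTwo.lean`)

Helper for the S6 floor sockets `R90.S6.StubR90ExtE1HeckeFL` (the `eH`-binder, `U(Φ₂)`-factor of `H_v`) and `R90.S6.StubR90ExtE1TwistedTransferFL`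
(`Cruxes/H413/Lines/R90_S6_FloorE1D.lean`); target (A.4) of the S6 W9-A sheet `R90/R90-C14-typ1/g2/S6_wave9A_targets.v1.db09522d8f01f282.lean` :95
(statement VERBATIM, namespace without `.Wave9A`), DAG r5 row E1.3.9.1.  PROOF = ★ W7-a.4 `R90.S6.coeff_toVector_comp_eq_of_memLaw`
[Theorems/R90S6HeckeCoeffIndepOfIso] with its `hsep` binder PAID by ★ W8-e `R90.S6.mem_orbit_of_ncard_orbit_eq_two` [Theorems/R90S6IndexSeparatesU2]
(the shell index separates the `K₀`-double cosets of `U(1,1)` at an inert place).  The residual binders `hσO σk hσk hk hfrob` are proof-route binders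
(they feed W8-e: `σ̄ = Frob_q ≠ id`); the conclusion does not mention them.

Cell `hodgecm-mathlib`, crux H413 (`stmt-HodgeConjecture-24833`), route of record `HCCMUnconditional`; programme R90-TF (brief `director/R90-BRIEF.v2.md`),
section S6 (base `R90-C14`), seat R90-C14-p02 (g2), card W9-A.4 (S6 dealer R90-C14-plan (g2) 2026-09-04T23:48:46Z).  Lane `--supports stmt-HodgeConjecture-24833
--as helper`; ONE theorem, no definition, no `sorry`, no instance, no notation; imports ★ Theorems only (never Lines).  HONEST LABEL: a helper theorem, count-neutral
until the E1.3.9 ∕ E1.4.4.5a assemblies consume it; HC_CM is proved only modulo the 7 printed citations (2 remaining named inputs: hLiu418 =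
stmt-HodgeConjecture-24832, h413 = stmt-HodgeConjecture-24833) until rung 0 closes.

## References
* [CartierCorvallis1979] P. Cartier, *Representations of p-adic groups: a survey*, Proc. Sympos. Pure Math. 33 (1979), Part 1, §IV.1.
* [BruhatTits1972] F. Bruhat, J. Tits, *Groupes réductifs sur un corps local I*, Publ. Math. IHÉS 41 (1972), (4.4.3), (4.4.4).
-/

set_option autoImplicit false
-- the mandated namespace repeats the single-problem summit's segment (`HodgeConjecture.HodgeConjecture`)
set_option linter.dupNamespace false

noncomputable section

open scoped Valued WithZero Matrix MatrixGroups

open MulAction MonoidAlgebra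
open Literature.NumberTheory.Automorphic Literature.NumberTheory.Automorphic.HermitianLattice

namespace Summit.HodgeConjecture.HodgeConjecture.R90.S6

variable {k : Type*} [CommRing k]
variable {K : Type*} [Field K] [Valued K ℤᵐ⁰] {σ : K →+* K} {ϖ : K}

/-- **W9-A.4 «eG-INDEPENDENCE» AT `N = 2`** (`U = U(σ, antidiag(1,1))(K)`, `K₀ = unitaryInt`, abstract unramified datum with residue field `𝔽_{q²}` on which `σ`
reduces to the `q`-Frobenius): any two group isomorphisms `e e' : Gv ≃* U` carrying `Kv` onto `K₀` read every `T ∈ ℋ(U, K₀)` as the SAME function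
`g ↦ (T [K₀])((e g) K₀)` on `Gv` — ★ W7-a.4 `coeff_toVector_comp_eq_of_memLaw` with `hsep :=` ★ W8-e `mem_orbit_of_ncard_orbit_eq_two`.
Statement = S6 W9-A sheet target (A.4) VERBATIM. [folklore; cite: CartierCorvallis1979, §IV.1] [cite: BruhatTits1972, (4.4.3)] -/
theorem coeff_toVector_comp_eq_of_memLaw_two (hd : UnramifiedLocalConjDatum σ ϖ) (hσO : ∀ x : 𝒪[K], σ x ∈ 𝒪[K]) (σk : 𝓀[K] →+* 𝓀[K])
    (hσk : ∀ x : 𝒪[K], IsLocalRing.residue 𝒪[K] ⟨σ x, hσO x⟩ = σk (IsLocalRing.residue 𝒪[K] x))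
    [Fintype 𝓀[K]] {q : ℕ} (hk : Fintype.card 𝓀[K] = q ^ 2) (hfrob : ∀ y, σk y = y ^ q)
    {Gv : Type*} [Group Gv] (Kv : Subgroup Gv)
    (e e' : Gv ≃* ↥(unitaryGroupOfForm σ ((StdForm.antidiagonal 2).over K)))
    (he : ∀ g, e g ∈ unitaryInt σ ((StdForm.antidiagonal 2).over K) ↔ g ∈ Kv)
    (he' : ∀ g, e' g ∈ unitaryInt σ ((StdForm.antidiagonal 2).over K) ↔ g ∈ Kv)
    (T : heckeAlgebra k ↥(unitaryGroupOfForm σ ((StdForm.antidiagonal 2).over K)) (unitaryInt σ ((StdForm.antidiagonal 2).over K))) :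
    (fun g : Gv => (heckeAlgebra.toVector (unitaryInt σ ((StdForm.antidiagonal 2).over K)) T).coeff
        ((e' g : ↥(unitaryGroupOfForm σ ((StdForm.antidiagonal 2).over K))) :
          ↥(unitaryGroupOfForm σ ((StdForm.antidiagonal 2).over K)) ⧸ unitaryInt σ ((StdForm.antidiagonal 2).over K))) =
      fun g : Gv => (heckeAlgebra.toVector (unitaryInt σ ((StdForm.antidiagonal 2).over K)) T).coeff
        ((e g : ↥(unitaryGroupOfForm σ ((StdForm.antidiagonal 2).over K))) :
          ↥(unitaryGroupOfForm σ ((StdForm.antidiagonal 2).over K)) ⧸ unitaryInt σ ((StdForm.antidiagonal 2).over K)) :=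
  coeff_toVector_comp_eq_of_memLaw Kv (unitaryInt σ ((StdForm.antidiagonal 2).over K))
    (fun u u' h => mem_orbit_of_ncard_orbit_eq_two hd hσO σk hσk hk hfrob u u' h) e e' he he' T

end Summit.HodgeConjecture.HodgeConjecture.R90.S6

end
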